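/- Width seat `ym-line-cbag-p1-w2` (prover-ym-line-cbag-p1-w2-g15-0; own items stmt-QuantumFields-22254 / 22893 CLOSED) on the
planner-of-record's LINE 4, route `U1DipoleHelicity`, crux `WilsonU1DipoleLawD4` (stmt-QuantumFields-25880): the Villain two-plaquette
function of the registered skeleton (`villainPlaqCorr`, object of stub 1 `stub_villainDipoleCalibration`) in Fröhlich–Spencer's dual
model — exact spin-wave × flux-gas identity.  Helper `--supports stmt-QuantumFields-25880`; no stub is closed here.  Nothing in this
file bears on the Yang–Mills mass gap (LINE 4 is the abelian comparison line onto the node `U1HelicityGapD4`). -/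
import Summits.QuantumFields.YangMills.Theorems.U1DipoleHelicityWilsonU1DipoleLawD4Defs
import Literature.MathematicalPhysics.QuantumFieldTheory.VillainSheetDuality
import Literature.MathematicalPhysics.QuantumFieldTheory.VillainSpinWaveKernelBounds
import HarnessLib

/-!
# Crux `WilsonU1DipoleLawD4` (stmt-QuantumFields-25880): the Villain two-plaquette function `villainPlaqCorr` in the dual model

The registered birth skeleton of the crux (planner ym-idea-2 g2) factors the Wilson `U(1)₄` dipole law through the VILLAIN dipole
law (stub 1, `stub_villainDipoleCalibration`: `|V_{βV,n}(z) − K(z)/β'| ≤ (C/βV)·w(z)` eventually in `n`, with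
`V_{βV,n}(z) = villainPlaqCorr βV n z = ⟨sin θ_{(0;0,1)} sin θ_{(z;0,1)}⟩^{Villain}_{box 4 n, βV}`).  This file puts the object of stub 1
into Fröhlich–Spencer's dual form (FS82 §2.4, §2.11), using the tree's duality transformation for a general integer sheet
(`Literature/…/VillainSheetDuality.lean`):

* `villainPlaqCorr_eq_halfOpenBox`: `V_{βV,n}(z)` is the two-plaquette function of the axial-gauge cube `B_{2n+1} = halfOpenBox 4 (2n+1)`
  at the translated plaquettes `p = (n𝟙; 0,1)`, `q = (z + n𝟙; 0,1)` (translation covariance);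
* `villainPlaqCorr_eq_spinWave_gas` (**the identity**): for `βV > 0` and `n ≥ ‖z‖_∞ + 1` (both plaquettes inside the cube),
  `V_{βV,n}(z) = ½ e^{−(E_p+E_q)/(2βV)} · ( e^{B_{pq}/βV} A⁻ − e^{−B_{pq}/βV} A⁺ )`,
  `E_p, E_q` the spin-wave energies of the single plaquettes, `B_{pq}` the spin-wave bilinear form (the free-boundary massless
  lattice-photon field-strength propagator of the cube), `A^∓ ∈ [−1, 1]` the flux-gas (monopole) averages of `cos` of the
  disorder phases of `δ_p ∓ δ_q` (`abs_gasAverage_le_one`);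
* `abs_villainPlaqCorr_sub_spinWave_le` (**where the monopoles enter**): with the pure spin-wave value
  `SW = e^{−(E_p+E_q)/(2βV)} sinh(B_{pq}/βV)` (the Gaussian dipole law of the cube),
  `|V_{βV,n}(z) − SW| ≤ ½ e^{−(E_p+E_q)/(2βV)} ( e^{B/βV}(1 − A⁻) + e^{−B/βV}(1 − A⁺) )`,
  i.e. the whole deviation from the Gaussian dipole law is carried by the monopole deficits `1 − A^∓ ≥ 0`.

Reading for the stub: `stub_villainDipoleCalibration` as typed (pointwise error `(C/βV)(1+|z|₁)^{−5}` with `C·Σw ≤ ε`, the SAME `β'`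
for all `z`) therefore needs (i) the convergence `B_{pq} → freeK(z)` of the cube's spin-wave kernel as `n → ∞` (potential theory,
free boundary conditions) and (ii) `z`-DECAY of the monopole deficits / of `A⁻ − A⁺` at precision `e^{−cβV}·(1+|z|)^{−5}` — clustering
of the flux gas, not merely the Jensen-type sandwich `1 − η ≤ A ≤ 1` that the tree's FS82 §2.6–§2.10 machinery (perimeter law)
provides: a `z`-uniform deficit `η` cannot be absorbed into `(C/βV)·w(z)` for large `|z|`.  This is recorded as a sizing note on
the item; nothing here proves the stub.

RECORD-type material on an abelian comparison line; the Yang–Mills mass gap is NOT proved by anything here.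
-/

set_option autoImplicit false

noncomputable section

namespace Summit.QuantumFields.YangMills.Theorems.U1DipoleHelicity

open MeasureTheory Finset
open scoped Matrix
open Literature.Probability.LatticeModels Literature.MathematicalPhysics.QuantumFieldTheory
open Literature.MathematicalPhysics.QuantumFieldTheory.VillainAngle
open Literature.MathematicalPhysics.QuantumFieldTheory.AxialGauge
open Literature.Probability.LatticeModels.GaussianCoord (gram exactPart perpPart exactEnergy)

/-! ### The two plaquettes inside the axial-gauge cube `B_{2n+1}` -/

/-- For `n ≥ ‖z‖_∞ + 1` the translated site `z + n𝟙` and its shift by `e₀ + e₁` lie in `B_{2n+1} = [0, 2n]⁴`. [folklore] -/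
theorem add_diag_mem_halfOpenBox (z : Literature.Probability.LatticeModels.Site 4) {n : ℕ} (hn : Site.supNorm z + 1 ≤ n) :
    z + diag 4 n ∈ halfOpenBox 4 (2 * n + 1) ∧
      z + diag 4 n + LatticeForm.e (0 : Fin 4) + LatticeForm.e (1 : Fin 4) ∈ halfOpenBox 4 (2 * n + 1) := by
  have hz : ∀ k : Fin 4, ((z k).natAbs : ℤ) + 1 ≤ n := fun k => by
    have := Site.natAbs_le_supNorm z k
    omega
  refine ⟨mem_halfOpenBox.2 fun k => ?_, mem_halfOpenBox.2 fun k => ?_⟩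
  · have h := hz k
    simp only [Pi.add_apply, VillainAngle.diag]
    omega
  · have h := hz k
    simp only [Pi.add_apply, VillainAngle.diag, LatticeForm.e, Pi.single_apply]
    split_ifs <;> push_cast <;> omega

/-- For `n ≥ ‖z‖_∞ + 1` the plaquette `(z + n𝟙; 0, 1)` is a plaquette of `B_{2n+1}`. [folklore] -/
theorem add_diag_mem_plaquettesIn (z : Literature.Probability.LatticeModels.Site 4) {n : ℕ} (hn : Site.supNorm z + 1 ≤ n) :
    (z + diag 4 n, (0 : Fin 4), (1 : Fin 4)) ∈ plaquettesIn (halfOpenBox 4 (2 * n + 1)) := by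
  obtain ⟨h1, h2⟩ := add_diag_mem_halfOpenBox z hn
  exact VillainFibre.mem_plaquettesIn_iff.2 ⟨by decide, h1, h2⟩

/-- For `n ≥ 1` the plaquette `(n𝟙; 0, 1)` is a plaquette of `B_{2n+1}`. [folklore] -/
theorem diag_mem_plaquettesIn {n : ℕ} (hn : 1 ≤ n) :
    (diag 4 n, (0 : Fin 4), (1 : Fin 4)) ∈ plaquettesIn (halfOpenBox 4 (2 * n + 1)) := by
  have h := add_diag_mem_plaquettesIn (0 : Literature.Probability.LatticeModels.Site 4) (n := n)
    (by simp [Site.supNorm]; exact hn)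
  rwa [zero_add] at h

/-- `‖z‖_∞ + 1 ≤ n` implies `1 ≤ n`. [folklore] -/
theorem one_le_of_supNorm_succ_le (z : Literature.Probability.LatticeModels.Site 4) {n : ℕ} (hn : Site.supNorm z + 1 ≤ n) :
    1 ≤ n := le_trans (Nat.le_add_left 1 _) hn

/-! ### `villainPlaqCorr` as a two-plaquette function of the axial-gauge cube -/

/-- **Translation to the axial-gauge cube**: `V_{βV,n}(z) = ⟨Im U_{(n𝟙;0,1)} · Im U_{(z+n𝟙;0,1)}⟩_{B_{2n+1}}(βV)` (`βV > 0`).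
[folklore] -/
theorem villainPlaqCorr_eq_halfOpenBox {βV : ℝ} (hβ : 0 < βV) (n : ℕ) (z : Literature.Probability.LatticeModels.Site 4) :
    villainPlaqCorr βV n z =
      zdVillainExpect (d := 4) βV (halfOpenBox 4 (2 * n + 1)) (fun U =>
        ((U.plaquette (diag 4 n) 0 1 : Circle) : ℂ).im * ((U.plaquette (z + diag 4 n) 0 1 : Circle) : ℂ).im) := by
  have h := zdVillainExpect_box_im_mul_im (d := 4) hβ n 0 z 0 1 0 1
  rw [zero_add] at h
  rw [h]
  rfl

/-! ### The dual (spin-wave × flux-gas) form -/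

/-- **The Villain two-plaquette function of crux 25880 in the dual model.**  For `βV > 0` and `n ≥ ‖z‖_∞ + 1`, with the plaquettes
`p = (n𝟙; 0,1)`, `q = (z + n𝟙; 0,1)` of `B_{2n+1}`, the spin-wave energies `E_p = E(δ_p)`, `E_q = E(δ_q)`, the spin-wave bilinear form
`B = (Tᵀδ_p)·(M⁻¹Tᵀδ_q)` (`T = dMat`, `M = TᵀT`) and the flux-gas averages `A^∓ = (∑_ξ g(ξ) cos⟨(2πξ)_⊥, δ_p ∓ δ_q⟩)/(∑_ξ g(ξ))`:
`V_{βV,n}(z) = ½ e^{−(E_p+E_q)/(2βV)} (e^{B/βV} A⁻ − e^{−B/βV} A⁺)`. [cite: FrohlichSpencerCMP1982, §2.4 (2.24), §2.11 (2.89)–(2.90)] -/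
theorem villainPlaqCorr_eq_spinWave_gas {βV : ℝ} (hβ : 0 < βV) (z : Literature.Probability.LatticeModels.Site 4) {n : ℕ}
    (hn : Site.supNorm z + 1 ≤ n) :
    villainPlaqCorr βV n z =
      1 / 2 * Real.exp (-(exactEnergy dMat (Pi.single (⟨(diag 4 n, 0, 1), diag_mem_plaquettesIn (one_le_of_supNorm_succ_le z hn)⟩ :
            PIdx 4 (2 * n + 1)) (1 : ℝ)) +
          exactEnergy dMat (Pi.single (⟨(z + diag 4 n, 0, 1), add_diag_mem_plaquettesIn z hn⟩ : PIdx 4 (2 * n + 1)) (1 : ℝ))) /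
          (2 * βV)) *
        (Real.exp (((dMatᵀ *ᵥ (Pi.single (⟨(diag 4 n, 0, 1), diag_mem_plaquettesIn (one_le_of_supNorm_succ_le z hn)⟩ :
                PIdx 4 (2 * n + 1)) (1 : ℝ) : PIdx 4 (2 * n + 1) → ℝ)) ⬝ᵥ
              ((gram (dMat (d := 4) (n := 2 * n + 1)))⁻¹ *ᵥ (dMatᵀ *ᵥ
                (Pi.single (⟨(z + diag 4 n, 0, 1), add_diag_mem_plaquettesIn z hn⟩ : PIdx 4 (2 * n + 1)) (1 : ℝ) :
                  PIdx 4 (2 * n + 1) → ℝ)))) / βV) *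
            ((∑' ξ : (PIdx 4 (2 * n + 1) → ℤ) ⧸ (VillainFibre.dFree (d := 4) (n := 2 * n + 1)).range,
                coulombWeight βV ξ * Real.cos (perpPart dMat (fluxRep ξ) ⬝ᵥ fun r =>
                  ((Pi.single (⟨(diag 4 n, 0, 1), diag_mem_plaquettesIn (one_le_of_supNorm_succ_le z hn)⟩ : PIdx 4 (2 * n + 1))
                      (1 : ℤ) -
                    Pi.single (⟨(z + diag 4 n, 0, 1), add_diag_mem_plaquettesIn z hn⟩ : PIdx 4 (2 * n + 1)) 1 :
                      PIdx 4 (2 * n + 1) → ℤ) r : ℝ))) /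
              ∑' ξ : (PIdx 4 (2 * n + 1) → ℤ) ⧸ (VillainFibre.dFree (d := 4) (n := 2 * n + 1)).range, coulombWeight βV ξ) -
          Real.exp (-((dMatᵀ *ᵥ (Pi.single (⟨(diag 4 n, 0, 1), diag_mem_plaquettesIn (one_le_of_supNorm_succ_le z hn)⟩ :
                PIdx 4 (2 * n + 1)) (1 : ℝ) : PIdx 4 (2 * n + 1) → ℝ)) ⬝ᵥ
              ((gram (dMat (d := 4) (n := 2 * n + 1)))⁻¹ *ᵥ (dMatᵀ *ᵥ
                (Pi.single (⟨(z + diag 4 n, 0, 1), add_diag_mem_plaquettesIn z hn⟩ : PIdx 4 (2 * n + 1)) (1 : ℝ) :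
                  PIdx 4 (2 * n + 1) → ℝ)))) / βV) *
            ((∑' ξ : (PIdx 4 (2 * n + 1) → ℤ) ⧸ (VillainFibre.dFree (d := 4) (n := 2 * n + 1)).range,
                coulombWeight βV ξ * Real.cos (perpPart dMat (fluxRep ξ) ⬝ᵥ fun r =>
                  ((Pi.single (⟨(diag 4 n, 0, 1), diag_mem_plaquettesIn (one_le_of_supNorm_succ_le z hn)⟩ : PIdx 4 (2 * n + 1))
                      (1 : ℤ) +
                    Pi.single (⟨(z + diag 4 n, 0, 1), add_diag_mem_plaquettesIn z hn⟩ : PIdx 4 (2 * n + 1)) 1 :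
                      PIdx 4 (2 * n + 1) → ℤ) r : ℝ))) /
              ∑' ξ : (PIdx 4 (2 * n + 1) → ℤ) ⧸ (VillainFibre.dFree (d := 4) (n := 2 * n + 1)).range, coulombWeight βV ξ)) := by
  rw [villainPlaqCorr_eq_halfOpenBox hβ]
  exact zdVillainExpect_im_mul_im_eq_spinWave_gas (d := 4) (n := 2 * n + 1) hβ
    ⟨(diag 4 n, 0, 1), diag_mem_plaquettesIn (one_le_of_supNorm_succ_le z hn)⟩
    ⟨(z + diag 4 n, 0, 1), add_diag_mem_plaquettesIn z hn⟩

/-! ### Where the monopoles enter: deviation from the Gaussian (spin-wave) dipole law -/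

/-- Elementary: with `|A⁻|, |A⁺| ≤ 1` and `c, u, v ≥ 0`,
`|½c(uA⁻ − vA⁺) − ½c(u − v)| ≤ ½c(u(1 − A⁻) + v(1 − A⁺))`. [folklore] -/
theorem abs_half_mul_sub_sinh_le {c u v Am Ap : ℝ} (hc : 0 ≤ c) (hu : 0 ≤ u) (hv : 0 ≤ v) (hAm : |Am| ≤ 1) (hAp : |Ap| ≤ 1) :
    |1 / 2 * c * (u * Am - v * Ap) - 1 / 2 * c * (u - v)| ≤ 1 / 2 * c * (u * (1 - Am) + v * (1 - Ap)) := by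
  have hAm1 : Am ≤ 1 := (abs_le.1 hAm).2
  have hAp1 : Ap ≤ 1 := (abs_le.1 hAp).2
  have h1 : 0 ≤ u * (1 - Am) := mul_nonneg hu (by linarith)
  have h2 : 0 ≤ v * (1 - Ap) := mul_nonneg hv (by linarith)
  have key : 1 / 2 * c * (u * Am - v * Ap) - 1 / 2 * c * (u - v) = 1 / 2 * c * (v * (1 - Ap) - u * (1 - Am)) := by ring
  rw [key, abs_le]
  constructor <;> nlinarith [mul_nonneg hc h1, mul_nonneg hc h2]

/-- **Deviation of the Villain two-plaquette function from the Gaussian dipole law of the cube is carried by the monopole deficits.**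
For `βV > 0`, `n ≥ ‖z‖_∞ + 1` and `p, q, E_p, E_q, B, A^∓` as in `villainPlaqCorr_eq_spinWave_gas`:
`|V_{βV,n}(z) − e^{−(E_p+E_q)/(2βV)}·½(e^{B/βV} − e^{−B/βV})| ≤ ½ e^{−(E_p+E_q)/(2βV)} (e^{B/βV}(1 − A⁻) + e^{−B/βV}(1 − A⁺))`,
with `1 − A^∓ ≥ 0` (`abs_gasAverage_le_one`).  The pure spin wave (`A^∓ = 1`) gives exactly the Gaussian value
`e^{−(E_p+E_q)/2βV} sinh(B/βV)`.  NB the deficits `1 − A^∓` do NOT themselves decay in `z`; a dipole law with `z`-decaying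
error needs the cancellation inside `e^{B/βV}A⁻ − e^{−B/βV}A⁺` after renormalising the amplitude (clustering of the flux gas; see
`villainDipoleCalibration_of_gas`), for which this bound is only the crude starting point. [cite: FrohlichSpencerCMP1982, §2.11 (2.89)–(2.90)] -/
theorem abs_villainPlaqCorr_sub_spinWave_le {βV : ℝ} (hβ : 0 < βV) (z : Literature.Probability.LatticeModels.Site 4) {n : ℕ}
    (hn : Site.supNorm z + 1 ≤ n) :
    |villainPlaqCorr βV n z -
        1 / 2 * Real.exp (-(exactEnergy dMat (Pi.single (⟨(diag 4 n, 0, 1), diag_mem_plaquettesIn (one_le_of_supNorm_succ_le z hn)⟩ :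
              PIdx 4 (2 * n + 1)) (1 : ℝ)) +
            exactEnergy dMat (Pi.single (⟨(z + diag 4 n, 0, 1), add_diag_mem_plaquettesIn z hn⟩ : PIdx 4 (2 * n + 1)) (1 : ℝ))) /
            (2 * βV)) *
          (Real.exp (((dMatᵀ *ᵥ (Pi.single (⟨(diag 4 n, 0, 1), diag_mem_plaquettesIn (one_le_of_supNorm_succ_le z hn)⟩ :
                  PIdx 4 (2 * n + 1)) (1 : ℝ) : PIdx 4 (2 * n + 1) → ℝ)) ⬝ᵥ
                ((gram (dMat (d := 4) (n := 2 * n + 1)))⁻¹ *ᵥ (dMatᵀ *ᵥ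
                  (Pi.single (⟨(z + diag 4 n, 0, 1), add_diag_mem_plaquettesIn z hn⟩ : PIdx 4 (2 * n + 1)) (1 : ℝ) :
                    PIdx 4 (2 * n + 1) → ℝ)))) / βV) -
            Real.exp (-((dMatᵀ *ᵥ (Pi.single (⟨(diag 4 n, 0, 1), diag_mem_plaquettesIn (one_le_of_supNorm_succ_le z hn)⟩ :
                  PIdx 4 (2 * n + 1)) (1 : ℝ) : PIdx 4 (2 * n + 1) → ℝ)) ⬝ᵥ
                ((gram (dMat (d := 4) (n := 2 * n + 1)))⁻¹ *ᵥ (dMatᵀ *ᵥ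
                  (Pi.single (⟨(z + diag 4 n, 0, 1), add_diag_mem_plaquettesIn z hn⟩ : PIdx 4 (2 * n + 1)) (1 : ℝ) :
                    PIdx 4 (2 * n + 1) → ℝ)))) / βV))| ≤
      1 / 2 * Real.exp (-(exactEnergy dMat (Pi.single (⟨(diag 4 n, 0, 1), diag_mem_plaquettesIn (one_le_of_supNorm_succ_le z hn)⟩ :
            PIdx 4 (2 * n + 1)) (1 : ℝ)) +
          exactEnergy dMat (Pi.single (⟨(z + diag 4 n, 0, 1), add_diag_mem_plaquettesIn z hn⟩ : PIdx 4 (2 * n + 1)) (1 : ℝ))) /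
          (2 * βV)) *
        (Real.exp (((dMatᵀ *ᵥ (Pi.single (⟨(diag 4 n, 0, 1), diag_mem_plaquettesIn (one_le_of_supNorm_succ_le z hn)⟩ :
                PIdx 4 (2 * n + 1)) (1 : ℝ) : PIdx 4 (2 * n + 1) → ℝ)) ⬝ᵥ
              ((gram (dMat (d := 4) (n := 2 * n + 1)))⁻¹ *ᵥ (dMatᵀ *ᵥ
                (Pi.single (⟨(z + diag 4 n, 0, 1), add_diag_mem_plaquettesIn z hn⟩ : PIdx 4 (2 * n + 1)) (1 : ℝ) :
                  PIdx 4 (2 * n + 1) → ℝ)))) / βV) *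
            (1 - (∑' ξ : (PIdx 4 (2 * n + 1) → ℤ) ⧸ (VillainFibre.dFree (d := 4) (n := 2 * n + 1)).range,
                coulombWeight βV ξ * Real.cos (perpPart dMat (fluxRep ξ) ⬝ᵥ fun r =>
                  ((Pi.single (⟨(diag 4 n, 0, 1), diag_mem_plaquettesIn (one_le_of_supNorm_succ_le z hn)⟩ : PIdx 4 (2 * n + 1))
                      (1 : ℤ) -
                    Pi.single (⟨(z + diag 4 n, 0, 1), add_diag_mem_plaquettesIn z hn⟩ : PIdx 4 (2 * n + 1)) 1 :
                      PIdx 4 (2 * n + 1) → ℤ) r : ℝ))) /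
              ∑' ξ : (PIdx 4 (2 * n + 1) → ℤ) ⧸ (VillainFibre.dFree (d := 4) (n := 2 * n + 1)).range, coulombWeight βV ξ) +
          Real.exp (-((dMatᵀ *ᵥ (Pi.single (⟨(diag 4 n, 0, 1), diag_mem_plaquettesIn (one_le_of_supNorm_succ_le z hn)⟩ :
                PIdx 4 (2 * n + 1)) (1 : ℝ) : PIdx 4 (2 * n + 1) → ℝ)) ⬝ᵥ
              ((gram (dMat (d := 4) (n := 2 * n + 1)))⁻¹ *ᵥ (dMatᵀ *ᵥ
                (Pi.single (⟨(z + diag 4 n, 0, 1), add_diag_mem_plaquettesIn z hn⟩ : PIdx 4 (2 * n + 1)) (1 : ℝ) :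
                  PIdx 4 (2 * n + 1) → ℝ)))) / βV) *
            (1 - (∑' ξ : (PIdx 4 (2 * n + 1) → ℤ) ⧸ (VillainFibre.dFree (d := 4) (n := 2 * n + 1)).range,
                coulombWeight βV ξ * Real.cos (perpPart dMat (fluxRep ξ) ⬝ᵥ fun r =>
                  ((Pi.single (⟨(diag 4 n, 0, 1), diag_mem_plaquettesIn (one_le_of_supNorm_succ_le z hn)⟩ : PIdx 4 (2 * n + 1))
                      (1 : ℤ) +
                    Pi.single (⟨(z + diag 4 n, 0, 1), add_diag_mem_plaquettesIn z hn⟩ : PIdx 4 (2 * n + 1)) 1 :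
                      PIdx 4 (2 * n + 1) → ℤ) r : ℝ))) /
              ∑' ξ : (PIdx 4 (2 * n + 1) → ℤ) ⧸ (VillainFibre.dFree (d := 4) (n := 2 * n + 1)).range, coulombWeight βV ξ)) := by
  rw [villainPlaqCorr_eq_spinWave_gas hβ z hn]
  exact abs_half_mul_sub_sinh_le (Real.exp_pos _).le (Real.exp_pos _).le (Real.exp_pos _).le
    (abs_gasAverage_le_one (d := 4) (n := 2 * n + 1) hβ _) (abs_gasAverage_le_one (d := 4) (n := 2 * n + 1) hβ _)

/-! ## Appended 2026-08-28 (same seat): uniform prefactors — the deviation from the spin wave is at most `½e^{1/βV}` times the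
monopole deficits

With `0 ≤ E_p, E_q` and `|B| ≤ 1` (`Literature/…/VillainSpinWaveKernelBounds.lean`: the spin-wave kernel is a matrix element of the
exact-part projection) the prefactors of `abs_villainPlaqCorr_sub_spinWave_le` are bounded uniformly in `n`, `z`:
`e^{−(E_p+E_q)/2βV} ≤ 1`, `e^{±B/βV} ≤ e^{1/βV}`.  CAVEAT for consumers (see the sizing note attached to stmt-QuantumFields-25880): the
deficits `1 − A^∓` do NOT themselves decay in `z` (as `|z| → ∞` they tend to `1 − A(δ_p)A(δ_q) > 0`, each plaquette's own monopole
dressing); a dipole law with `z`-decaying error needs the cancellation inside `e^{B/βV}A⁻ − e^{−B/βV}A⁺` after renormalising the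
amplitude `β'` — clustering of the flux gas — for which these bounds are only the bookkeeping frame. -/

/-- Elementary monotonicity: `½a(ux + vy) ≤ ½w(x + y)` for `a ≤ 1`, `0 ≤ u, v ≤ w`, `0 ≤ x, y`. [folklore] -/
theorem half_mul_weighted_le {a u v w x y : ℝ} (ha1 : a ≤ 1) (hu : 0 ≤ u) (huw : u ≤ w) (hv : 0 ≤ v)
    (hvw : v ≤ w) (hx : 0 ≤ x) (hy : 0 ≤ y) :
    1 / 2 * a * (u * x + v * y) ≤ 1 / 2 * w * (x + y) := by
  have h1 : u * x ≤ w * x := mul_le_mul_of_nonneg_right huw hx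
  have h2 : v * y ≤ w * y := mul_le_mul_of_nonneg_right hvw hy
  have h3 : a * (u * x + v * y) ≤ 1 * (w * x + w * y) :=
    mul_le_mul ha1 (add_le_add h1 h2) (add_nonneg (mul_nonneg hu hx) (mul_nonneg hv hy)) zero_le_one
  nlinarith [h3]

/-- **Deviation from the spin wave, uniform prefactor.**  For `βV > 0`, `n ≥ ‖z‖_∞ + 1`, with `p, q, E_p, E_q, B, A^∓` as in
`villainPlaqCorr_eq_spinWave_gas`:
`|V_{βV,n}(z) − ½e^{−(E_p+E_q)/2βV}(e^{B/βV} − e^{−B/βV})| ≤ ½ e^{1/βV} ((1 − A⁻) + (1 − A⁺))`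
(`0 ≤ E_p, E_q`, `|B| ≤ 1`, `|A^∓| ≤ 1`).  See the caveat above: this isolates, but does not estimate, the monopole content.
[cite: FrohlichSpencerCMP1982, §2.11 (2.89)–(2.90)] -/
theorem abs_villainPlaqCorr_sub_spinWave_le_deficits {βV : ℝ} (hβ : 0 < βV) (z : Literature.Probability.LatticeModels.Site 4)
    {n : ℕ} (hn : Site.supNorm z + 1 ≤ n) :
    |villainPlaqCorr βV n z -
        1 / 2 * Real.exp (-(exactEnergy dMat (Pi.single (⟨(diag 4 n, 0, 1), diag_mem_plaquettesIn (one_le_of_supNorm_succ_le z hn)⟩ :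
              PIdx 4 (2 * n + 1)) (1 : ℝ)) +
            exactEnergy dMat (Pi.single (⟨(z + diag 4 n, 0, 1), add_diag_mem_plaquettesIn z hn⟩ : PIdx 4 (2 * n + 1)) (1 : ℝ))) /
            (2 * βV)) *
          (Real.exp (((dMatᵀ *ᵥ (Pi.single (⟨(diag 4 n, 0, 1), diag_mem_plaquettesIn (one_le_of_supNorm_succ_le z hn)⟩ :
                  PIdx 4 (2 * n + 1)) (1 : ℝ) : PIdx 4 (2 * n + 1) → ℝ)) ⬝ᵥ
                ((gram (dMat (d := 4) (n := 2 * n + 1)))⁻¹ *ᵥ (dMatᵀ *ᵥ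
                  (Pi.single (⟨(z + diag 4 n, 0, 1), add_diag_mem_plaquettesIn z hn⟩ : PIdx 4 (2 * n + 1)) (1 : ℝ) :
                    PIdx 4 (2 * n + 1) → ℝ)))) / βV) -
            Real.exp (-((dMatᵀ *ᵥ (Pi.single (⟨(diag 4 n, 0, 1), diag_mem_plaquettesIn (one_le_of_supNorm_succ_le z hn)⟩ :
                  PIdx 4 (2 * n + 1)) (1 : ℝ) : PIdx 4 (2 * n + 1) → ℝ)) ⬝ᵥ
                ((gram (dMat (d := 4) (n := 2 * n + 1)))⁻¹ *ᵥ (dMatᵀ *ᵥ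
                  (Pi.single (⟨(z + diag 4 n, 0, 1), add_diag_mem_plaquettesIn z hn⟩ : PIdx 4 (2 * n + 1)) (1 : ℝ) :
                    PIdx 4 (2 * n + 1) → ℝ)))) / βV))| ≤
      1 / 2 * Real.exp (1 / βV) *
        ((1 - (∑' ξ : (PIdx 4 (2 * n + 1) → ℤ) ⧸ (VillainFibre.dFree (d := 4) (n := 2 * n + 1)).range,
                coulombWeight βV ξ * Real.cos (perpPart dMat (fluxRep ξ) ⬝ᵥ fun r =>
                  ((Pi.single (⟨(diag 4 n, 0, 1), diag_mem_plaquettesIn (one_le_of_supNorm_succ_le z hn)⟩ : PIdx 4 (2 * n + 1))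
                      (1 : ℤ) -
                    Pi.single (⟨(z + diag 4 n, 0, 1), add_diag_mem_plaquettesIn z hn⟩ : PIdx 4 (2 * n + 1)) 1 :
                      PIdx 4 (2 * n + 1) → ℤ) r : ℝ))) /
              ∑' ξ : (PIdx 4 (2 * n + 1) → ℤ) ⧸ (VillainFibre.dFree (d := 4) (n := 2 * n + 1)).range, coulombWeight βV ξ) +
          (1 - (∑' ξ : (PIdx 4 (2 * n + 1) → ℤ) ⧸ (VillainFibre.dFree (d := 4) (n := 2 * n + 1)).range,
                coulombWeight βV ξ * Real.cos (perpPart dMat (fluxRep ξ) ⬝ᵥ fun r =>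
                  ((Pi.single (⟨(diag 4 n, 0, 1), diag_mem_plaquettesIn (one_le_of_supNorm_succ_le z hn)⟩ : PIdx 4 (2 * n + 1))
                      (1 : ℤ) +
                    Pi.single (⟨(z + diag 4 n, 0, 1), add_diag_mem_plaquettesIn z hn⟩ : PIdx 4 (2 * n + 1)) 1 :
                      PIdx 4 (2 * n + 1) → ℤ) r : ℝ))) /
              ∑' ξ : (PIdx 4 (2 * n + 1) → ℤ) ⧸ (VillainFibre.dFree (d := 4) (n := 2 * n + 1)).range, coulombWeight βV ξ)) := by
  refine (abs_villainPlaqCorr_sub_spinWave_le hβ z hn).trans ?_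
  set p : PIdx 4 (2 * n + 1) := ⟨(diag 4 n, 0, 1), diag_mem_plaquettesIn (one_le_of_supNorm_succ_le z hn)⟩
  set q : PIdx 4 (2 * n + 1) := ⟨(z + diag 4 n, 0, 1), add_diag_mem_plaquettesIn z hn⟩
  have hEp := exactEnergy_single_nonneg (d := 4) (n := 2 * n + 1) p
  have hEq := exactEnergy_single_nonneg (d := 4) (n := 2 * n + 1) q
  have hB := abs_le.1 (abs_bilin_single_le_one (d := 4) (n := 2 * n + 1) p q)
  have hAm := abs_le.1 (abs_gasAverage_le_one (d := 4) (n := 2 * n + 1) hβ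
    (fun r => ((Pi.single p (1 : ℤ) - Pi.single q 1 : PIdx 4 (2 * n + 1) → ℤ) r : ℝ)))
  have hAp := abs_le.1 (abs_gasAverage_le_one (d := 4) (n := 2 * n + 1) hβ
    (fun r => ((Pi.single p (1 : ℤ) + Pi.single q 1 : PIdx 4 (2 * n + 1) → ℤ) r : ℝ)))
  refine half_mul_weighted_le ?_ (Real.exp_pos _).le ?_ (Real.exp_pos _).le ?_ ?_ ?_
  · rw [Real.exp_le_one_iff, neg_div]
    exact neg_nonpos.2 (div_nonneg (add_nonneg hEp hEq) (by positivity))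
  · exact Real.exp_le_exp.2 (div_le_div_of_nonneg_right hB.2 hβ.le)
  · exact Real.exp_le_exp.2 (div_le_div_of_nonneg_right (by linarith [hB.1]) hβ.le)
  · linarith [hAm.2]
  · linarith [hAp.2]

end Summit.QuantumFields.YangMills.Theorems.U1DipoleHelicity

end
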